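import Summits.QuantumFields.GaugeBoot.TiltedBoxAxisFlips
import HarnessLib

/-!
# Axis swaps of a periodic lattice and of the 45°-tilted box: invariance of the Wilson measure (gauge-boot, L3(υ) supplement)

HONEST FRAMING (cell `pub-gaugeboot`, page 1 of every file): the venture produces certified bounds
on lattice expectations at stated coupling, gauge group, dimension and torus size; NOT a mass gap,
NOT a continuum limit, NOT a string tension; NOT Yang–Mills-summit-bearing (barriers
`FixedCouplingUltralocality`, `PerturbativeInvisibility`).

Companion of `TiltedLatticeAxisFlip.lean` completing the SYMMETRY input of a bootstrap on the
45°-tilted periodic box (Kazakov–Zheng arXiv:2203.11360 §3.3): an **axis swap** of a periodic lattice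
`(A, e)` is an additive involution `θ : A →+ A` exchanging two marked translations and fixing the
others, `θ (e m) = e ((k l) m)` (`IsAxisSwap`; this is the part of a tilted diagonal frame
`IsTiltedFrame` of `TiltedRPGeometry.lean` that does not concern positivity —
`IsTiltedFrame.isAxisSwap`). The induced map of configurations is `configSwap k l θ` of
`TiltedRPGeometry.lean` (no link reversal), and the Wilson measure is invariant under it for every
real `β` (`IsAxisSwap.integral_comp_configSwap_gibbs`; proofs as in `TiltedRPCut.lean` /
`TiltedRPPositivity.lean`, which used only these two axioms).

On the tilted box `TiltedSite d i j M_u M_v L` the swap of two axes `k, l ∉ {i, j}` (both of period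
`L`) is a lattice automorphism (`tiltedLattice_le_comap_swapHom_other`, `tiltedAxisSwap`), whence
`tiltedBox_integral_comp_axisSwap`; the swap `i ↔ j` is the diagonal mirror of `TiltedBox.lean`
(`tiltedBox_integral_comp_configSwap`, `M_v ≥ 2` there). With the translations
(`TiltedLatticeSymmetry.lean`) and the flips (`TiltedBoxAxisFlips.lean`) these generate the symmetry
group of the box that an SDP may quotient by.

References: V. Kazakov, Z. Zheng, arXiv:2203.11360 §3.3 (reduction by the symmetry group).
-/

noncomputable section

open MeasureTheory Complex QuotientAddGroup
open Literature.MathematicalPhysics.QuantumFieldTheory (haarProbability)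
open Literature.RepresentationTheory.CompactGroups

namespace Summit.QuantumFields.GaugeBoot

namespace TiltedRP

variable {A : Type*} [AddCommGroup A] {d : ℕ}

/-- **An axis swap** of the periodic lattice `(A, e)`: an additive involution `θ` with
`θ (e m) = e ((k l) m)` for every direction `m`. -/
structure IsAxisSwap (e : Fin d → A) (k l : Fin d) (θ : A →+ A) : Prop where
  /-- The swap exchanges `e k`, `e l` and fixes the other translations. -/
  map_e : ∀ m, θ (e m) = e (Equiv.swap k l m)
  /-- The swap is an involution. -/
  invol : ∀ x, θ (θ x) = x

/-- Every tilted diagonal frame is an axis swap. -/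
theorem IsTiltedFrame.isAxisSwap {e : Fin d → A} {i j : Fin d} {θ : A →+ A} {P : ℕ}
    {v : A →+ ZMod (2 * P)} (hF : IsTiltedFrame e i j θ P v) : IsAxisSwap e i j θ :=
  ⟨hF.map_e, hF.invol⟩

namespace IsAxisSwap

variable {e : Fin d → A} {k l : Fin d} {θ : A →+ A}
variable (hF : IsAxisSwap e k l θ)
include hF

/-! ## The swap on sites, links, configurations, plaquettes -/

/-- `θ (x + e m) = θ x + e ((k l) m)`. -/
theorem map_add_e (x : A) (m : Fin d) : θ (x + e m) = θ x + e (Equiv.swap k l m) := by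
  rw [map_add, hF.map_e]

/-- `linkSwap` is an involution. -/
theorem linkSwap_linkSwap (q : Link A d) : linkSwap k l θ (linkSwap k l θ q) = q := by
  obtain ⟨x, m⟩ := q
  simp [hF.invol, Equiv.swap_apply_self]

/-- `linkSwap` is involutive. -/
theorem linkSwap_involutive : Function.Involutive (linkSwap (d := d) k l θ) := hF.linkSwap_linkSwap

/-- `configSwap` is an involution. -/
theorem configSwap_configSwap {G : Type*} (U : Config A d G) :
    configSwap k l θ (configSwap k l θ U) = U := by
  funext q
  simp [hF.linkSwap_linkSwap]

/-- `plaqSwap` is an involution. -/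
theorem plaqSwap_plaqSwap (p : Plaq A d) : plaqSwap k l θ (plaqSwap k l θ p) = p := by
  obtain ⟨x, ⟨⟨m, n⟩, hmn⟩⟩ := p
  have hmn' : m < n := hmn
  by_cases h1 : Equiv.swap k l m < Equiv.swap k l n
  · rw [plaqSwap_of_lt k l θ x hmn' h1,
      plaqSwap_of_lt k l θ _ h1 (by simpa [Equiv.swap_apply_self] using hmn')]
    simp [Equiv.swap_apply_self, hF.invol]
  · rw [plaqSwap_of_not_lt k l θ x hmn' h1,
      plaqSwap_of_not_lt k l θ _ _ (by simpa [Equiv.swap_apply_self] using not_lt.2 hmn'.le)]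
    simp [Equiv.swap_apply_self, hF.invol]

/-! ## Holonomies and the action under the swap -/

section Holonomy

variable {N : ℕ} {G : Type*} [Group G]

/-- `(ΘU)` has at `(x; m, n)` the holonomy of `U` at `(θx; (k l) m, (k l) n)`. -/
theorem holonomy_configSwap (U : Config A d G) (x : A) (m n : Fin d) :
    holonomy e (configSwap k l θ U) x m n =
      holonomy e U (θ x) (Equiv.swap k l m) (Equiv.swap k l n) := by
  simp only [holonomy, configSwap_apply, linkSwap_mk, hF.map_add_e]

/-- The holonomy of `ΘU` around `p` is the holonomy of `U` around `plaqSwap p`, or its inverse. -/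
theorem holonomy_configSwap_eq_or (U : Config A d G) (p : Plaq A d) :
    holonomy e (configSwap k l θ U) p.1 p.2.1.1 p.2.1.2 = holonomy e U (plaqSwap k l θ p).1
        (plaqSwap k l θ p).2.1.1 (plaqSwap k l θ p).2.1.2 ∨
      holonomy e (configSwap k l θ U) p.1 p.2.1.1 p.2.1.2 = (holonomy e U (plaqSwap k l θ p).1
        (plaqSwap k l θ p).2.1.1 (plaqSwap k l θ p).2.1.2)⁻¹ := by
  obtain ⟨x, ⟨⟨m, n⟩, hmn⟩⟩ := p
  have hmn' : m < n := hmn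
  rw [hF.holonomy_configSwap]
  by_cases h : Equiv.swap k l m < Equiv.swap k l n
  · rw [plaqSwap_of_lt k l θ x hmn' h]
    exact Or.inl rfl
  · rw [plaqSwap_of_not_lt k l θ x hmn' h]
    exact Or.inr (by rw [← holonomy_swap_dirs])

variable [TopologicalSpace G] [IsTopologicalGroup G] [CompactSpace G]
variable (ρ : G →* Matrix (Fin N) (Fin N) ℂ)

/-- **`Re tr ρ((ΘU)_p) = Re tr ρ(U_{plaqSwap p})`.** -/
theorem plaqObs_configSwap (hρ : Continuous ρ) (p : Plaq A d) (U : Config A d G) :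
    plaqObs ρ e p (configSwap k l θ U) = plaqObs ρ e (plaqSwap k l θ p) U := by
  unfold plaqObs
  rcases hF.holonomy_configSwap_eq_or U p with h | h
  · rw [h]
  · rw [h, CompactGroup.re_trace_map_inv ρ hρ]

/-- **The Wilson action is swap invariant**: `S(ΘU) = S(U)`. -/
theorem wilsonAction_configSwap [Fintype A] (hρ : Continuous ρ) (U : Config A d G) :
    wilsonAction ρ e (configSwap k l θ U) = wilsonAction ρ e U := by
  rw [wilsonAction_eq, wilsonAction_eq]
  congr 1
  exact Fintype.sum_equiv (Function.Involutive.toPerm (plaqSwap k l θ) hF.plaqSwap_plaqSwap) _ _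
    fun p => hF.plaqObs_configSwap ρ hρ p U

end Holonomy

/-! ## The swap preserves the product Haar measure and the Wilson measure -/

section Measure

variable [Fintype A] {N : ℕ} {G : Type*} [Group G] [TopologicalSpace G] [IsTopologicalGroup G]
  [CompactSpace G] [MeasurableSpace G] [BorelSpace G]
variable (ρ : G →* Matrix (Fin N) (Fin N) ℂ)

/-- The swap of links as a permutation. -/
def linkPerm (hF : IsAxisSwap e k l θ) : Equiv.Perm (Link A d) :=
  Function.Involutive.toPerm (linkSwap k l θ) hF.linkSwap_involutive

omit [Fintype A] [Group G] [TopologicalSpace G] [IsTopologicalGroup G] [CompactSpace G] [BorelSpace G] in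
/-- `configSwap` is precomposition with `linkPerm`. -/
theorem configSwap_eq_arrowCongr :
    (configSwap (G := G) k l θ : Config A d G → Config A d G) =
      ⇑(MeasurableEquiv.arrowCongr' hF.linkPerm (MeasurableEquiv.refl G)) := by
  funext U q; rfl

/-- **The swap preserves the product Haar measure** (a relabelling of the factors). -/
theorem measurePreserving_configSwap :
    MeasurePreserving (configSwap (G := G) k l θ) (productHaar A d G) (productHaar A d G) := by
  haveI : IsProbabilityMeasure (haarProbability G) :=
    CompactGroup.isProbabilityMeasure_haarMeasure_top
  have h := measurePreserving_arrowCongr' (fun _ : Link A d => haarProbability G)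
    (fun _ : Link A d => haarProbability G) hF.linkPerm (MeasurableEquiv.refl G)
    fun _ => MeasurePreserving.id _
  rw [hF.configSwap_eq_arrowCongr]
  exact h

variable [SecondCountableTopology G]

/-- **Swap invariance of the Wilson measure**: `∫ F(ΘU) dμ_β = ∫ F dμ_β` (measurable real `F`,
every real `β`). -/
theorem integral_comp_configSwap_gibbs (hρ : Continuous ρ) (β : ℝ) {F : Config A d G → ℝ}
    (hFm : Measurable F) :
    ∫ U, F (configSwap k l θ U) ∂(gibbs ρ e β) = ∫ U, F U ∂(gibbs ρ e β) := by
  rw [integral_gibbs, integral_gibbs]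
  set Z := ∫ U, Real.exp (-β * wilsonAction ρ e U) ∂(productHaar A d G)
  have h1 : ∀ U : Config A d G, (Real.exp (-β * wilsonAction ρ e U) / Z) • F (configSwap k l θ U) =
      (fun V : Config A d G => (Real.exp (-β * wilsonAction ρ e V) / Z) • F V)
        (configSwap k l θ U) := by
    intro U
    simp only [hF.wilsonAction_configSwap ρ hρ]
  have hm : Measurable fun V : Config A d G => (Real.exp (-β * wilsonAction ρ e V) / Z) • F V :=
    (((continuous_boltzmann ρ hρ e β).measurable).div_const _).smul hFm
  simp_rw [h1]
  rw [← integral_map hF.measurePreserving_configSwap.measurable.aemeasurable hm.aestronglyMeasurable,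
    hF.measurePreserving_configSwap.map_eq]

/-- Swap invariance of the Wilson measure, complex observables. -/
theorem integral_comp_configSwap_gibbs_complex (hρ : Continuous ρ) (β : ℝ) {F : Config A d G → ℂ}
    (hFm : Measurable F) :
    ∫ U, F (configSwap k l θ U) ∂(gibbs ρ e β) = ∫ U, F U ∂(gibbs ρ e β) := by
  rw [integral_gibbs, integral_gibbs]
  set Z := ∫ U, Real.exp (-β * wilsonAction ρ e U) ∂(productHaar A d G)
  have h1 : ∀ U : Config A d G, (Real.exp (-β * wilsonAction ρ e U) / Z) • F (configSwap k l θ U) =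
      (fun V : Config A d G => (Real.exp (-β * wilsonAction ρ e V) / Z) • F V)
        (configSwap k l θ U) := by
    intro U
    simp only [hF.wilsonAction_configSwap ρ hρ]
  have hm : Measurable fun V : Config A d G => (Real.exp (-β * wilsonAction ρ e V) / Z) • F V :=
    (((continuous_boltzmann ρ hρ e β).measurable).div_const _).smul hFm
  simp_rw [h1]
  rw [← integral_map hF.measurePreserving_configSwap.measurable.aemeasurable hm.aestronglyMeasurable,
    hF.measurePreserving_configSwap.map_eq]

end Measure

end IsAxisSwap

/-! ## The axis swaps of the tilted box -/

section Box

variable (d : ℕ) {i j k l : Fin d} (Mu Mv L : ℕ)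

/-- `Γ` is invariant under the swap of two axes `k, l ∉ {i, j}` (both of period `L`). -/
theorem tiltedLattice_le_comap_swapHom_other (hki : k ≠ i) (hkj : k ≠ j) (hli : l ≠ i) (hlj : l ≠ j) :
    tiltedLattice d i j Mu Mv L ≤ (tiltedLattice d i j Mu Mv L).comap (swapHom d k l) := by
  intro x hx
  rw [AddSubgroup.mem_comap, mem_tiltedLattice_iff]
  rw [mem_tiltedLattice_iff] at hx
  obtain ⟨h1, h2, h3⟩ := hx
  simp only [swapHom_apply, Equiv.swap_apply_of_ne_of_ne hki.symm hli.symm,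
    Equiv.swap_apply_of_ne_of_ne hkj.symm hlj.symm]
  refine ⟨h1, h2, fun m hmi hmj => ?_⟩
  by_cases hmk : m = k
  · subst hmk; rw [Equiv.swap_apply_left]; exact h3 l hli hlj
  · by_cases hml : m = l
    · subst hml; rw [Equiv.swap_apply_right]; exact h3 k hki hkj
    · rw [Equiv.swap_apply_of_ne_of_ne hmk hml]; exact h3 m hmi hmj

/-- **The swap of two axes `k, l ∉ {i, j}` of the tilted box**: `[x] ↦ [x ∘ (k l)]`. -/
def tiltedAxisSwap (hki : k ≠ i) (hkj : k ≠ j) (hli : l ≠ i) (hlj : l ≠ j) :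
    TiltedSite d i j Mu Mv L →+ TiltedSite d i j Mu Mv L :=
  QuotientAddGroup.map _ _ (swapHom d k l)
    (tiltedLattice_le_comap_swapHom_other d Mu Mv L hki hkj hli hlj)

/-- The axis swap on classes. -/
theorem tiltedAxisSwap_mk (hki : k ≠ i) (hkj : k ≠ j) (hli : l ≠ i) (hlj : l ≠ j) (x : Fin d → ℤ) :
    tiltedAxisSwap d Mu Mv L hki hkj hli hlj (x : TiltedSite d i j Mu Mv L) =
      ((swapHom d k l x : Fin d → ℤ) : TiltedSite d i j Mu Mv L) := rfl

/-- **The swap of two axes `k, l ∉ {i, j}` is an axis swap of the periodic lattice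
`(TiltedSite, tiltedUnit)`.** -/
theorem isAxisSwap_tiltedBox (hki : k ≠ i) (hkj : k ≠ j) (hli : l ≠ i) (hlj : l ≠ j) :
    IsAxisSwap (tiltedUnit d i j Mu Mv L) k l (tiltedAxisSwap d Mu Mv L hki hkj hli hlj) where
  map_e m := by
    show tiltedAxisSwap d Mu Mv L hki hkj hli hlj
      ((Pi.single m (1 : ℤ) : Fin d → ℤ) : TiltedSite d i j Mu Mv L) = _
    rw [tiltedAxisSwap_mk, swapHom_single]
    rfl
  invol q := by
    induction q using QuotientAddGroup.induction_on with
    | H x =>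
      rw [tiltedAxisSwap_mk, tiltedAxisSwap_mk]
      congr 1
      funext m
      simp [Equiv.swap_apply_self]

variable {d Mu Mv L} {N : ℕ} [NeZero Mu] [NeZero Mv] [NeZero L]
variable {G : Type*} [Group G] [TopologicalSpace G] [IsTopologicalGroup G] [CompactSpace G]
  [MeasurableSpace G] [BorelSpace G] [SecondCountableTopology G]
variable (ρ : G →* Matrix (Fin N) (Fin N) ℂ)

/-- **The Wilson measure of the tilted box is invariant under the swap of two axes `k, l ∉ {i, j}`**
(every real `β`, measurable real `F`; `(ΘU)(x, m) = U(x ∘ (k l), (k l) m)`, no link reversal). -/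
theorem tiltedBox_integral_comp_axisSwap (hki : k ≠ i) (hkj : k ≠ j) (hli : l ≠ i) (hlj : l ≠ j)
    (hρ : Continuous ρ) (β : ℝ) {F : Config (TiltedSite d i j Mu Mv L) d G → ℝ} (hFm : Measurable F) :
    ∫ U, F (configSwap k l (tiltedAxisSwap d Mu Mv L hki hkj hli hlj) U)
        ∂(gibbs ρ (tiltedUnit d i j Mu Mv L) β) =
      ∫ U, F U ∂(gibbs ρ (tiltedUnit d i j Mu Mv L) β) :=
  (isAxisSwap_tiltedBox d Mu Mv L hki hkj hli hlj).integral_comp_configSwap_gibbs ρ hρ β hFm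

/-- The same for complex observables. -/
theorem tiltedBox_integral_comp_axisSwap_complex (hki : k ≠ i) (hkj : k ≠ j) (hli : l ≠ i)
    (hlj : l ≠ j) (hρ : Continuous ρ) (β : ℝ) {F : Config (TiltedSite d i j Mu Mv L) d G → ℂ}
    (hFm : Measurable F) :
    ∫ U, F (configSwap k l (tiltedAxisSwap d Mu Mv L hki hkj hli hlj) U)
        ∂(gibbs ρ (tiltedUnit d i j Mu Mv L) β) =
      ∫ U, F U ∂(gibbs ρ (tiltedUnit d i j Mu Mv L) β) :=
  (isAxisSwap_tiltedBox d Mu Mv L hki hkj hli hlj).integral_comp_configSwap_gibbs_complex ρ hρ β hFm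

/-- **The Wilson measure of the tilted box is invariant under the diagonal swap `i ↔ j` for every
`M_v ≥ 1`** (the frame of `TiltedBox.lean` needed `i ≠ j` and `M_v ≥ 2`, which only positivity
uses). -/
theorem tiltedBox_integral_comp_configSwap_anyWidth (hρ : Continuous ρ) (β : ℝ)
    {F : Config (TiltedSite d i j Mu Mv L) d G → ℝ} (hFm : Measurable F) :
    ∫ U, F (configSwap i j (tiltedMirror d i j Mu Mv L) U) ∂(gibbs ρ (tiltedUnit d i j Mu Mv L) β) =
      ∫ U, F U ∂(gibbs ρ (tiltedUnit d i j Mu Mv L) β) := by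
  have hS : IsAxisSwap (tiltedUnit d i j Mu Mv L) i j (tiltedMirror d i j Mu Mv L) :=
    { map_e := fun m => by
        show tiltedMirror d i j Mu Mv L ((Pi.single m (1 : ℤ) : Fin d → ℤ) : TiltedSite d i j Mu Mv L) = _
        rw [tiltedMirror_mk, swapHom_single]
        rfl
      invol := fun q => by
        induction q using QuotientAddGroup.induction_on with
        | H x =>
          rw [tiltedMirror_mk, tiltedMirror_mk]
          congr 1
          funext m
          simp [Equiv.swap_apply_self] }
  exact hS.integral_comp_configSwap_gibbs ρ hρ β hFm

end Box

end TiltedRP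

end Summit.QuantumFields.GaugeBoot
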